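import Literature.GroupTheory.CombinatorialGroupTheory.CyclicBlockInterchangeBinary
import Literature.GroupTheory.CombinatorialGroupTheory.ThreeDMToCBI
import HarnessLib

/-!
# Discharge of `Heuer2020_clNPComplete` (Heuer 2020, Thm. 1)

[Heuer2020, Thm. 1]: "For any integer `r ≥ 2`, CL-`F_r` is NP-complete." The named fact
`Heuer2020_clNPComplete` of `CommutatorLengthNP.lean` states, for every rank `r ≥ 2`,
membership `clLanguage r ∈ NP` and NP-hardness with respect to polynomial-time Turing reductions
(`NP ⊆ PRel (clLanguage r)`, exactly what Heuer's Theorem 2 delivers, cf. his §5). This file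
assembles the proof from the vendored developments:

* membership (`CommutatorLengthNPMembership/Assembly.lean`, Bardakov's certificate) and the climb
  in the rank (`CommutatorLengthNPRank.lean`) reduce the fact to NP-hardness of CBI-`F₂`
  (`CyclicBlockInterchangeReduction.lean`: Heuer's Thm. 2, CBI-`F_r ≤ᵀₚ` CL-`F_r`, via
  `CyclicBlockInterchange{,Transport,Surgery,Cl}.lean`);
* CBI-`F₄ ≤ₚ` CBI-`F₂` (`CyclicBlockInterchangeBinary.lean`, Heuer's Lemma 4.6 via
  `CyclicBlockInterchange{Tracking,Encoding}.lean`);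
* NP-hardness of CBI-`F₄` (`ThreeDMToCBI.lean`): `THREEDM ≤ₚ` CBI-`F₄` by the 4-PARTITION
  instance of [GareyJohnson1979, Thm. 4.3] (`FourPartitionOfThreeDM.lean`) fed into Heuer's
  §4.1 gadget with families of four (`FourPartitionGadget.lean`, `CyclicBlockInterchangeNu.lean`),
  on top of the tree's NP-hardness of `THREEDM` (from Schaefer's ONE-IN-THREE SAT).

## References

* [Heuer2020] N. Heuer, *Computing commutator length is hard*, arXiv:2001.10230, Thm. 1, Thm. 2,
  Thm. 3, §4, §5.
* [GareyJohnson1979] M. R. Garey, D. S. Johnson, *Computers and Intractability*, 1979, Thm. 4.3.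
-/

namespace Literature.GroupTheory.CombinatorialGroupTheory

/-- **Heuer 2020, Theorem 1**: for every `r ≥ 2`, CL-`F_r` is in `NP` and NP-hard under
polynomial-time Turing reductions — the discharge of the named fact `Heuer2020_clNPComplete`.
[cite: Heuer2020, Thm. 1] -/
theorem Heuer2020_clNPComplete_holds : Heuer2020_clNPComplete :=
  Heuer2020_clNPComplete_of_cbi_four_isNPHard TDMCBI.isNPHard_cbiLanguage_four

end Literature.GroupTheory.CombinatorialGroupTheory
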